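import Mathlib
import HarnessLib
import Summits.RiemannHypothesis.RiemannHypothesis.Theorems.IntegerScrewSmoothSectorDefs
import Summits.RiemannHypothesis.RiemannHypothesis.Theorems.ScrewLemmaKProfileBernoulli
import Summits.RiemannHypothesis.RiemannHypothesis.Theorems.ScrewLemmaKCoprofileDefs
import Summits.RiemannHypothesis.RiemannHypothesis.Theorems.ScrewLemmaKCoprofileCalculus
import Summits.RiemannHypothesis.RiemannHypothesis.Theorems.ScrewLemmaKCoprofileSquareIntegrable

/-!
# K1 density step, part A: `C²` approximants and the linear estimates (route ScrewLemmaKCoprofile)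

Inputs of the `C² → C¹` density argument for crux K1 `CoprofileIsometry` (stmt-RiemannHypothesis-21612;
desk brief rh-idea-5 SKETCH-21612-K1.md §2), all RH-free real analysis:

* `exists_smooth_approx` — for `g ∈ C¹[0,1]` with `g(1) = 0`, `∫₀¹ g = 0` and `ε > 0` there is `p ∈ C²(ℝ)` with
  `p(1) = 0`, `∫₀¹ p = 0`, `sup_[0,1] |p′ − g′| ≤ ε` and `|p(0) − g(0)| ≤ ε` (Weierstrass on `g′ = derivWithin g [0,1]`,
  primitive from `1`, one linear correction by `2(1 − u)`);
* `abs_profile_sub_profile_le` — linearity + the exact Euler–Maclaurin formula (`ProfileBernoulli.profile_sub_plateau_eq`):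
  `|ψ_p(y) − ψ_g(y)| ≤ δ/2` for every `y > 0` when `|p′ − g′| ≤ δ` on `[0,1]`;
* `abs_coprofile_sub_coprofile_le` / `integral_coprofile_sub_sq_le` — `|Φ_p(t) − Φ_g(t)| ≤ δ(1 + log(1/t))` off the
  null set `{1/n}`, hence `∫₀¹ (Φ_p − Φ_g)² ≤ 50 δ²`;
(The measure-theoretic limit lemmas of the density step are in `ScrewLemmaKCoprofileDensityLimit`.)

Nothing here bears on the truth of RH; RH is not proved by this file or this route.
-/

noncomputable section

set_option linter.dupNamespace false

namespace Summit.RiemannHypothesis.RiemannHypothesis.Theorems.ScrewLemmaKCoprofile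

open MeasureTheory Set Filter Topology
open Summit.RiemannHypothesis.RiemannHypothesis.Theorems.IntegerScrew
open scoped BigOperators

/-! ## FTC with the one-sided derivative `g′ = derivWithin g [0,1]` -/

/-- `∫ₐ¹ g′ = g(1) − g(a)` for `a ∈ [0,1]`, with `g′ = derivWithin g [0,1]` (continuous up to the boundary).
[folklore] -/
theorem integral_derivWithin_eq_sub {g : ℝ → ℝ} (hC : ContDiffOn ℝ 1 g (Icc 0 1)) {a : ℝ}
    (ha : a ∈ Icc (0:ℝ) 1) :
    ∫ x in a..1, derivWithin g (Icc 0 1) x = g 1 - g a := by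
  have hcont : ContinuousOn (derivWithin g (Icc 0 1)) (Icc 0 1) :=
    continuousOn_derivWithin_Icc_of_contDiffOn hC
  refine intervalIntegral.integral_eq_sub_of_hasDeriv_right_of_le ha.2
    (hC.continuousOn.mono (Icc_subset_Icc ha.1 le_rfl)) (fun x hx => ?_)
    ((hcont.mono (Icc_subset_Icc ha.1 le_rfl)).intervalIntegrable_of_Icc ha.2)
  have hx' : x ∈ Ioo (0:ℝ) 1 := ⟨lt_of_le_of_lt ha.1 hx.1, hx.2⟩
  rw [derivWithin_Icc_eq_deriv hx']
  exact (hasDerivAt_of_contDiffOn_Icc hC hx').hasDerivWithinAt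

/-- `|∫ₐ¹ (q − g′)| ≤ C·(1 − a)` when `|q − g′| ≤ C` on `[0,1]` (`a ∈ [0,1]`). [folklore] -/
theorem abs_integral_sub_derivWithin_le {g q : ℝ → ℝ} {C a : ℝ} (ha : a ∈ Icc (0:ℝ) 1)
    (hq : ∀ x ∈ Icc (0:ℝ) 1, |q x - derivWithin g (Icc 0 1) x| ≤ C) :
    |∫ x in a..1, (q x - derivWithin g (Icc 0 1) x)| ≤ C * (1 - a) := by
  have h := intervalIntegral.norm_integral_le_of_norm_le_const (a := a) (b := 1) (C := C)
    (f := fun x => q x - derivWithin g (Icc 0 1) x) (fun x hx => by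
      rw [uIoc_of_le ha.2] at hx
      rw [Real.norm_eq_abs]
      exact hq x ⟨ha.1.trans hx.1.le, hx.2⟩)
  rw [Real.norm_eq_abs, abs_of_nonneg (show (0:ℝ) ≤ 1 - a by linarith [ha.2])] at h
  exact h

/-! ## `C²` approximants preserving `p(1) = 0` and `∫₀¹ p = 0` -/

/-- `∫₀¹ 2(1 − u) du = 1`. [folklore] -/
theorem integral_two_mul_one_sub : ∫ u in (0:ℝ)..1, 2 * (1 - u) = 1 := by
  have e : (fun u : ℝ => 2 * (1 - u)) = fun u => 2 - 2 * u := by funext u; ring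
  have hi : IntervalIntegrable (fun u : ℝ => 2 * u) volume 0 1 :=
    (continuous_const.mul continuous_id).intervalIntegrable _ _
  rw [e, intervalIntegral.integral_sub intervalIntegrable_const hi, intervalIntegral.integral_const,
    intervalIntegral.integral_const_mul, integral_id]
  norm_num

/-- **`C²` approximation in the `C¹` seminorm, inside the class `{p(1) = 0, ∫₀¹p = 0}`.**  For
`g ∈ C¹[0,1]` with `g(1) = 0`, `∫₀¹ g = 0` and `ε > 0` there is `p : ℝ → ℝ` of class `C²` on `ℝ` with
`p(1) = 0`, `∫₀¹ p = 0`, `|p′(u) − g′(u)| ≤ ε` on `[0,1]` (`g′ = derivWithin g [0,1]`) and `|p(0) − g(0)| ≤ ε`.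
Construction: Weierstrass polynomial `q ≈ g′`, `P(u) = ∫₁ᵘ q`, `p = P − (∫₀¹P)·2(1 − u)`. [folklore] -/
theorem exists_smooth_approx {g : ℝ → ℝ} (hC : ContDiffOn ℝ 1 g (Icc 0 1)) (h1 : g 1 = 0)
    (hI : ∫ u in (0:ℝ)..1, g u = 0) {ε : ℝ} (hε : 0 < ε) :
    ∃ p : ℝ → ℝ, ContDiff ℝ 2 p ∧ p 1 = 0 ∧ (∫ u in (0:ℝ)..1, p u) = 0 ∧
      (∀ u ∈ Icc (0:ℝ) 1, |deriv p u - derivWithin g (Icc 0 1) u| ≤ ε) ∧ |p 0 - g 0| ≤ ε := by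
  set g' : ℝ → ℝ := derivWithin g (Icc 0 1) with hg'
  have hg'c : ContinuousOn g' (Icc 0 1) := continuousOn_derivWithin_Icc_of_contDiffOn hC
  obtain ⟨q, hq⟩ := exists_polynomial_near_of_continuousOn 0 1 g' hg'c (ε / 3) (by positivity)
  have hqc : Continuous fun x => q.eval x := q.continuous
  -- the primitive from 1
  set P : ℝ → ℝ := fun u => ∫ x in (1:ℝ)..u, q.eval x with hP
  have hPd : ∀ u, HasDerivAt P (q.eval u) u := fun u =>
    intervalIntegral.integral_hasDerivAt_right (hqc.intervalIntegrable _ _)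
      (hqc.stronglyMeasurableAtFilter _ _) hqc.continuousAt
  have hP1 : P 1 = 0 := by simp [hP]
  have hPderiv : deriv P = fun u => q.eval u := funext fun u => (hPd u).deriv
  have hPdiff : Differentiable ℝ P := fun u => (hPd u).differentiableAt
  have hPcont : Continuous P := hPdiff.continuous
  have hqC1 : ContDiff ℝ 1 fun x => q.eval x := by
    rw [contDiff_one_iff_deriv]
    refine ⟨q.differentiable, ?_⟩
    have : deriv (fun x => q.eval x) = fun x => q.derivative.eval x := funext fun x => q.deriv
    rw [this]; exact q.derivative.continuous
  have hPC2 : ContDiff ℝ 2 P := by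
    rw [show (2 : WithTop ℕ∞) = 1 + 1 by norm_num, contDiff_succ_iff_deriv]
    exact ⟨hPdiff, fun h => absurd h (by simp), by rw [hPderiv]; exact hqC1⟩
  -- `|P − g| ≤ ε/3` on `[0,1]`
  have hPg : ∀ u ∈ Icc (0:ℝ) 1, |P u - g u| ≤ ε / 3 := by
    intro u hu
    have hFTC := integral_derivWithin_eq_sub hC hu
    rw [h1, zero_sub] at hFTC
    have hPu : P u = -∫ x in u..1, q.eval x := by
      rw [hP]; simp only; rw [intervalIntegral.integral_symm]
    have hqi : IntervalIntegrable (fun x => q.eval x) volume u 1 := hqc.intervalIntegrable _ _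
    have hgi : IntervalIntegrable g' volume u 1 :=
      (hg'c.mono (Icc_subset_Icc hu.1 le_rfl)).intervalIntegrable_of_Icc hu.2
    have e : P u - g u = -∫ x in u..1, (q.eval x - g' x) := by
      rw [intervalIntegral.integral_sub hqi hgi, hPu, hFTC]; ring
    rw [e, abs_neg]
    have hb := abs_integral_sub_derivWithin_le (g := g) (q := fun x => q.eval x) hu
      (fun x hx => (hq x hx).le)
    calc |∫ x in u..1, (q.eval x - g' x)| ≤ ε / 3 * (1 - u) := hb
      _ ≤ ε / 3 * 1 := by gcongr; linarith [hu.1]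
      _ = ε / 3 := mul_one _
  -- the correction constant
  set c : ℝ := ∫ u in (0:ℝ)..1, P u with hc
  have hgi01 : IntervalIntegrable g volume 0 1 := by
    refine (hC.continuousOn.mono ?_).intervalIntegrable
    rw [uIcc_of_le zero_le_one]
  have hPi01 : IntervalIntegrable P volume 0 1 := hPcont.intervalIntegrable _ _
  have hcb : |c| ≤ ε / 3 := by
    have e : c = ∫ u in (0:ℝ)..1, (P u - g u) := by
      rw [intervalIntegral.integral_sub hPi01 hgi01, hI, sub_zero]
    rw [e]
    have h := intervalIntegral.norm_integral_le_of_norm_le_const (a := (0:ℝ)) (b := 1) (C := ε / 3)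
      (f := fun u => P u - g u) (fun x hx => by
        rw [uIoc_of_le zero_le_one] at hx
        rw [Real.norm_eq_abs]; exact hPg x ⟨hx.1.le, hx.2⟩)
    simpa using h
  -- the approximant
  refine ⟨fun u => P u - c * (2 * (1 - u)), ?_, ?_, ?_, ?_, ?_⟩
  · exact hPC2.sub (contDiff_const.mul (contDiff_const.mul (contDiff_const.sub contDiff_id)))
  · simp [hP1]
  · have h2i : IntervalIntegrable (fun u : ℝ => c * (2 * (1 - u))) volume 0 1 :=
      (continuous_const.mul (continuous_const.mul (continuous_const.sub continuous_id))).intervalIntegrable _ _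
    show (∫ u in (0:ℝ)..1, (P u - c * (2 * (1 - u)))) = 0
    rw [intervalIntegral.integral_sub hPi01 h2i, intervalIntegral.integral_const_mul, integral_two_mul_one_sub, ← hc]
    ring
  · intro u hu
    have hd : HasDerivAt (fun u => P u - c * (2 * (1 - u))) (q.eval u - c * (2 * (0 - 1))) u :=
      (hPd u).sub ((((hasDerivAt_const u (1:ℝ)).sub (hasDerivAt_id u)).const_mul 2).const_mul c)
    rw [hd.deriv]
    have h1' := hq u hu
    calc |q.eval u - c * (2 * (0 - 1)) - g' u| = |(q.eval u - g' u) + 2 * c| := by ring_nf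
      _ ≤ |q.eval u - g' u| + |2 * c| := abs_add_le _ _
      _ ≤ ε / 3 + 2 * (ε / 3) := by
          rw [abs_mul, abs_two]
          exact add_le_add h1'.le (by linarith)
      _ = ε := by ring
  · have h0 := hPg 0 ⟨le_rfl, zero_le_one⟩
    calc |P 0 - c * (2 * (1 - 0)) - g 0| = |(P 0 - g 0) + -(2 * c)| := by ring_nf
      _ ≤ |P 0 - g 0| + |-(2 * c)| := abs_add_le _ _
      _ ≤ ε / 3 + 2 * (ε / 3) := by
          rw [abs_neg, abs_mul, abs_two]
          exact add_le_add h0 (by linarith)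
      _ = ε := by ring


/-! ## Linearity: the profile and the co-profile of a difference -/

/-- `ψ` is linear in the generator: `ψ_{p−g} = ψ_p − ψ_g` (finite sums). [folklore] -/
theorem profile_sub_plateau_sub (p g : ℝ → ℝ) (y : ℝ) :
    latticeProfile (fun u => p u - g u) y - latticePlateau (fun u => p u - g u)
      = (latticeProfile p y - latticePlateau p) - (latticeProfile g y - latticePlateau g) := by
  unfold latticeProfile latticePlateau
  rw [Finset.sum_sub_distrib]
  ring

/-- Off `[0,1]`-boundary effects: at every `u ∈ (0,1)`, `(p − g)′(u) = p′(u) − g′(u)` with `g′ = derivWithin g [0,1]`,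
for `p` differentiable and `g ∈ C¹[0,1]`. [folklore] -/
theorem deriv_sub_eq_of_mem_Ioo {p g : ℝ → ℝ} (hp : Differentiable ℝ p) (hC : ContDiffOn ℝ 1 g (Icc 0 1))
    {u : ℝ} (hu : u ∈ Ioo (0:ℝ) 1) :
    deriv (fun x => p x - g x) u = deriv p u - derivWithin g (Icc 0 1) u := by
  rw [derivWithin_Icc_eq_deriv hu]
  exact ((hp u).hasDerivAt.sub (hasDerivAt_of_contDiffOn_Icc hC hu)).deriv

/-- **Uniform closeness of profiles.**  If `p ∈ C¹(ℝ)`, `g ∈ C¹[0,1]`, both with `·(1) = 0` and `∫₀¹ · = 0`, and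
`|p′ − g′| ≤ δ` on `[0,1]`, then `|ψ_p(y) − ψ_g(y)| ≤ δ/2` for every `y > 0` (exact Euler–Maclaurin formula for
`p − g` and `|fract − ½| ≤ ½`). [folklore] -/
theorem abs_profile_sub_profile_le {p g : ℝ → ℝ} (hp : ContDiff ℝ 1 p) (hp1 : p 1 = 0)
    (hpI : ∫ u in (0:ℝ)..1, p u = 0) (hC : ContDiffOn ℝ 1 g (Icc 0 1)) (h1 : g 1 = 0)
    (hI : ∫ u in (0:ℝ)..1, g u = 0) {δ : ℝ}
    (hδ : ∀ u ∈ Icc (0:ℝ) 1, |deriv p u - derivWithin g (Icc 0 1) u| ≤ δ) {y : ℝ} (hy : 0 < y) :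
    |(latticeProfile p y - latticePlateau p) - (latticeProfile g y - latticePlateau g)| ≤ δ / 2 := by
  have hfC : ContDiffOn ℝ 1 (fun u => p u - g u) (Icc 0 1) := hp.contDiffOn.sub hC
  have hf1 : (fun u => p u - g u) 1 = 0 := by simp [hp1, h1]
  have hgi : IntervalIntegrable g volume 0 1 := by
    refine (hC.continuousOn.mono ?_).intervalIntegrable
    rw [uIcc_of_le zero_le_one]
  have hfI : ∫ u in (0:ℝ)..1, (fun u => p u - g u) u = 0 := by
    show ∫ u in (0:ℝ)..1, (p u - g u) = 0
    rw [intervalIntegral.integral_sub (hp.continuous.intervalIntegrable _ _) hgi, hpI, hI, sub_zero]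
  rw [← profile_sub_plateau_sub, ProfileBernoulli.profile_sub_plateau_eq hfC hf1 hfI hy]
  have hae : ∀ᵐ u : ℝ, u ∈ Set.uIoc (0:ℝ) 1 →
      ‖(Int.fract (u / y) - 1 / 2) * deriv (fun x => p x - g x) u‖ ≤ δ / 2 := by
    filter_upwards [(Set.countable_singleton (1:ℝ)).ae_notMem volume] with u hu1 hu
    rw [uIoc_of_le zero_le_one] at hu
    have hu' : u ∈ Ioo (0:ℝ) 1 := ⟨hu.1, lt_of_le_of_ne hu.2 hu1⟩
    rw [deriv_sub_eq_of_mem_Ioo hp.differentiable_one hC hu', Real.norm_eq_abs, abs_mul]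
    have hfr : |Int.fract (u / y) - 1 / 2| ≤ 1 / 2 := by
      rw [abs_le]; constructor
      · linarith [Int.fract_nonneg (u / y)]
      · linarith [Int.fract_lt_one (u / y)]
    have hd := hδ u (Ioo_subset_Icc_self hu')
    calc |Int.fract (u / y) - 1 / 2| * |deriv p u - derivWithin g (Icc 0 1) u|
        ≤ (1 / 2) * δ := mul_le_mul hfr hd (abs_nonneg _) (by norm_num)
      _ = δ / 2 := by ring
  have h := intervalIntegral.norm_integral_le_of_norm_le_const_ae hae
  rw [Real.norm_eq_abs] at h
  simpa using h

/-- The plateau is linear too: `|h₀(p) − h₀(g)| = |p(0) − g(0)|/2`. [folklore] -/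
theorem abs_plateau_sub_plateau (p g : ℝ → ℝ) :
    |latticePlateau p - latticePlateau g| = |p 0 - g 0| / 2 := by
  unfold latticePlateau
  rw [show -(p 0) / 2 - -(g 0) / 2 = -((p 0 - g 0) / 2) by ring, abs_neg, abs_div, abs_two]

/-! ## The co-profile of a difference, off the null set `{1/n}` -/

/-- `Φ` is linear in `g′` termwise: `Φ_p(t) − Φ_g(t) = Σ_{n ≤ 1/t} (p′(nt) − g′(nt))/n` (no hypotheses). [folklore] -/
theorem latticeCoprofile_sub (p g : ℝ → ℝ) (t : ℝ) :
    latticeCoprofile p t - latticeCoprofile g t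
      = ∑ n ∈ Finset.Icc 1 ⌊1 / t⌋₊, (deriv p (n * t) - deriv g (n * t)) / n := by
  unfold latticeCoprofile
  rw [← Finset.sum_sub_distrib]
  refine Finset.sum_congr rfl fun n _ => ?_
  ring

/-- **Co-profile closeness off `{1/n}`.**  If `|p′ − g′| ≤ δ` on `[0,1]` (`g′ = derivWithin g [0,1]`, `δ ≥ 0`) then
for `t ∈ (0,1)` with `n·t ≠ 1` for all `n`, `|Φ_p(t) − Φ_g(t)| ≤ δ(1 + log(1/t))` — all sample points `nt` lie in
the open interval, where `deriv g = g′`; harmonic sum `≤ 1 + log N`. [folklore] -/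
theorem abs_coprofile_sub_coprofile_le {p g : ℝ → ℝ} {δ : ℝ} (hδ0 : 0 ≤ δ)
    (hδ : ∀ u ∈ Icc (0:ℝ) 1, |deriv p u - derivWithin g (Icc 0 1) u| ≤ δ)
    {t : ℝ} (ht : t ∈ Ioo (0:ℝ) 1) (hS : ∀ n : ℕ, (n:ℝ) * t ≠ 1) :
    |latticeCoprofile p t - latticeCoprofile g t| ≤ δ * (1 + Real.log (1 / t)) := by
  rw [latticeCoprofile_sub]
  have ht0 : 0 < t := ht.1
  have h1t : 1 ≤ 1 / t := by rw [le_div_iff₀ ht0]; linarith [ht.2]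
  have hN1 : 1 ≤ ⌊1 / t⌋₊ := (Nat.one_le_floor_iff _).mpr h1t
  have hNpos : (0:ℝ) < (⌊1 / t⌋₊ : ℝ) := by exact_mod_cast hN1
  have hNle : (⌊1 / t⌋₊ : ℝ) ≤ 1 / t := Nat.floor_le (by positivity)
  calc |∑ n ∈ Finset.Icc 1 ⌊1 / t⌋₊, (deriv p (n * t) - deriv g (n * t)) / n|
      ≤ ∑ n ∈ Finset.Icc 1 ⌊1 / t⌋₊, |(deriv p (n * t) - deriv g (n * t)) / n| :=
        Finset.abs_sum_le_sum_abs _ _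
    _ ≤ ∑ n ∈ Finset.Icc 1 ⌊1 / t⌋₊, δ * ((1 : ℝ) / n) := by
        refine Finset.sum_le_sum fun n hn => ?_
        rw [Finset.mem_Icc] at hn
        have hn1 : (1:ℝ) ≤ n := by exact_mod_cast hn.1
        have hnpos : (0:ℝ) < n := by linarith
        have hnt : (n : ℝ) * t ∈ Ioo (0:ℝ) 1 := by
          refine ⟨by positivity, lt_of_le_of_ne ?_ (hS n)⟩
          have h3 : (n : ℝ) ≤ 1 / t := le_trans (by exact_mod_cast hn.2) hNle
          calc (n : ℝ) * t ≤ (1 / t) * t := mul_le_mul_of_nonneg_right h3 ht0.le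
            _ = 1 := by field_simp
        rw [abs_div, abs_of_pos hnpos, div_eq_mul_one_div]
        refine mul_le_mul_of_nonneg_right ?_ (by positivity)
        have h := hδ _ (Ioo_subset_Icc_self hnt)
        rwa [derivWithin_Icc_eq_deriv hnt] at h
    _ = δ * ∑ n ∈ Finset.Icc 1 ⌊1 / t⌋₊, (1 : ℝ) / n := by rw [Finset.mul_sum]
    _ ≤ δ * (1 + Real.log (⌊1 / t⌋₊ : ℝ)) :=
        mul_le_mul_of_nonneg_left (sum_Icc_inv_le_one_add_log hN1) hδ0
    _ ≤ δ * (1 + Real.log (1 / t)) :=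
        mul_le_mul_of_nonneg_left (by linarith [Real.log_le_log hNpos hNle]) hδ0

/-- The exceptional set `{t : ∃ n, n·t = 1}` is countable (it lies in `{1/n}`), hence Lebesgue-null. [folklore] -/
theorem ae_forall_nat_mul_ne_one : ∀ᵐ t : ℝ, ∀ n : ℕ, (n:ℝ) * t ≠ 1 := by
  have hc : ({t : ℝ | ∃ n : ℕ, (n:ℝ) * t = 1}).Countable := by
    refine (Set.countable_range (fun n : ℕ => ((n:ℝ))⁻¹)).mono ?_
    rintro t ⟨n, hn⟩
    refine ⟨n, ?_⟩
    have hn0 : (n:ℝ) ≠ 0 := by rintro h; rw [h, zero_mul] at hn; exact zero_ne_one hn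
    field_simp
    linarith
  filter_upwards [hc.ae_notMem volume] with t ht n hn
  exact ht ⟨n, hn⟩

/-- `∫₀¹ t^{−1/2} dt = 2` on `Ioo 0 1`. [folklore] -/
theorem integral_Ioo_rpow_neg_half : ∫ t in Ioo (0:ℝ) 1, t ^ (-(1 / 2 : ℝ)) = 2 := by
  rw [← integral_Ioc_eq_integral_Ioo, ← intervalIntegral.integral_of_le zero_le_one,
    integral_rpow (Or.inl (by norm_num))]
  norm_num

/-- **`L²` closeness of co-profiles**: `|p′ − g′| ≤ δ` on `[0,1]` implies `∫₀¹ (Φ_p − Φ_g)² ≤ 50 δ²`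
(`(1 + log(1/t))² ≤ 25 t^{−1/2}` a.e., tree `one_add_log_inv_le_rpow`). [folklore] -/
theorem integral_coprofile_sub_sq_le {p g : ℝ → ℝ} {δ : ℝ} (hδ0 : 0 ≤ δ)
    (hδ : ∀ u ∈ Icc (0:ℝ) 1, |deriv p u - derivWithin g (Icc 0 1) u| ≤ δ) :
    ∫ t in Ioo (0:ℝ) 1, (latticeCoprofile p t - latticeCoprofile g t) ^ 2 ≤ 50 * δ ^ 2 := by
  have hdom : IntegrableOn (fun t : ℝ => (5 * δ) ^ 2 * t ^ (-(1 / 2 : ℝ))) (Ioo 0 1) := by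
    have h := (intervalIntegral.intervalIntegrable_rpow' (a := 0) (b := 1) (r := -(1 / 2 : ℝ))
      (by norm_num))
    rw [intervalIntegrable_iff_integrableOn_Ioo_of_le zero_le_one] at h
    exact h.const_mul _
  have hle : ∫ t in Ioo (0:ℝ) 1, (latticeCoprofile p t - latticeCoprofile g t) ^ 2
      ≤ ∫ t in Ioo (0:ℝ) 1, (5 * δ) ^ 2 * t ^ (-(1 / 2 : ℝ)) := by
    refine integral_mono_of_nonneg (ae_of_all _ fun t => sq_nonneg _) hdom ?_
    filter_upwards [ae_restrict_mem measurableSet_Ioo, ae_restrict_of_ae ae_forall_nat_mul_ne_one]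
      with t ht hS
    have ht0 : 0 < t := ht.1
    have hΦ : |latticeCoprofile p t - latticeCoprofile g t| ≤ δ * (5 * t ^ (-(1 / 4 : ℝ))) :=
      (abs_coprofile_sub_coprofile_le hδ0 hδ ht hS).trans
        (mul_le_mul_of_nonneg_left (one_add_log_inv_le_rpow ht) hδ0)
    have hsq : (t ^ (-(1 / 4 : ℝ))) ^ 2 = t ^ (-(1 / 2 : ℝ)) := by
      rw [sq, ← Real.rpow_add ht0]; norm_num
    calc (latticeCoprofile p t - latticeCoprofile g t) ^ 2
        = |latticeCoprofile p t - latticeCoprofile g t| ^ 2 := (sq_abs _).symm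
      _ ≤ (δ * (5 * t ^ (-(1 / 4 : ℝ)))) ^ 2 := pow_le_pow_left₀ (abs_nonneg _) hΦ 2
      _ = (5 * δ) ^ 2 * (t ^ (-(1 / 4 : ℝ))) ^ 2 := by ring
      _ = (5 * δ) ^ 2 * t ^ (-(1 / 2 : ℝ)) := by rw [hsq]
  refine hle.trans ?_
  rw [MeasureTheory.integral_const_mul, integral_Ioo_rpow_neg_half]
  nlinarith [sq_nonneg δ]

end Summit.RiemannHypothesis.RiemannHypothesis.Theorems.ScrewLemmaKCoprofile

end
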